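import Summits.CriticalPhenomena.CardyFormulaZ2.Theorems.CardyIKTransportIKLinearTransportTwoCutDefs

/-!
# Stub `stub_TwoSidedCutMarkovKernel` (K₂) — part 1: THE TWO-SIDED KERNEL (definition, factorisation assembly,
# measurability, normalisation, cut-Markov reading, two-sided environment-locality)

Support file (`--supports stmt-CriticalPhenomena-5076`, lead c2; registered sub-goal `tc_readsEnv`).

THE VERSION `tcK i T`. At a statistic value `t = (p, z)`:
* if the environment `p` has a cut row below `0` AND a cut row above `0` (`tcBoth`: `cmkCstar i p ≤ -1`, `1 ≤ cmkCfirst i p`),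
  the CANONICAL ATOM VERSION: the conditional probability under `νmix T` of the middle row `0` given the atom
  `tcEv i t = tcAtom i p ∩ tcZev i (cmkCstar i p) z` of (window data of `p`, middle rows `(c, 0)` of `z`) — a ratio of the
  masses of two cylinder-like events (a fixed unit vector when the atom is null);
* otherwise the landed one-sided version `cmkK i T` of `…StubCutMarkovKernelKernel.lean`.
By construction it reads the past only above the last cut (`tc_kernel_reads`) and, between two cut rows present in two
environments agreeing on the strip rows between them, it does not distinguish the environments (`tc_readsEnv`: `ReadsEnv`).
Also here: the assembly of the factorisation identity `TcFactorisation` from the rectangle property `TcGaugeRect` and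
the abstract rectangle identity `TcRectIdentity` (`tc_factorisation_of`), and measurability / nonnegativity /
normalisation of `tcK`. The `law` field (from `TcFactorisation` and `cmk_kernel_law`) is part 2.
-/

noncomputable section

namespace Summit.CriticalPhenomena.CardyFormulaZ2.Theorems.IKLinearTransport.PinnedDiagramExchange

open scoped Classical MeasureTheory ENNReal symmDiff
open Set MeasureTheory
open Literature.Probability.Percolation Literature.Probability.LatticeModels

/-! ## §1 The factorisation identity from the rectangle property and the abstract identity -/

/-- ASSEMBLY: `TcGaugeRect i T` and the abstract rectangle identity along the inner noise give `TcFactorisation i T`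
(push everything to the coded bits through `νmix T = SDE.PJ.map (cmkΞ i T c)`). [folklore] -/
theorem tc_factorisation_of (i : ℤ) (T : Set ℤ) (hG : TcGaugeRect i T) (hR : ∀ A : Set SDE.JIdx, TcRectIdentity A) :
    TcFactorisation i T := by
  intro p z hc hc' A hA y
  set c := cmkCstar i p with hcdef
  obtain ⟨h1, h2, h3⟩ := hG p z hc hc'
  have hΞ : Measurable (cmkΞ i T c) := cmk_measurable_Ξ i T c
  have hν : νmix T = SDE.PJ.map (cmkΞ i T c) := cmk_nuMix_eq_map_Xi i T c
  have hEv : MeasurableSet (tcAtom i p ∩ tcZev i c z) := (measurableSet_tcAtom i p).inter (measurableSet_tcZev i c z)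
  have hRS : MeasurableSet {x : Obs | rowStat i x ∈ A} := (measurable_rowStat i) hA
  have hRB : MeasurableSet {x : Obs | rowBool i x = y} := (measurable_rowBool i) (measurableSet_singleton y)
  have key := hR (tcNin i (decide (i ∈ T)) c (cmkCfirst i p)) (tcE i T p z) (measurableSet_tcE i T p z) h1
    (fun g => rowBool i (cmkΞ i T c g)) (fun g => rowStat i (cmkΞ i T c g)) ((measurable_rowBool i).comp hΞ)
    ((measurable_rowStat i).comp hΞ) h2 h3 A hA y
  have e1 : νmix T ({x | rowStat i x ∈ A} ∩ (tcAtom i p ∩ tcZev i c z) ∩ {x | rowBool i x = y}) =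
      SDE.PJ (tcE i T p z ∩ (fun g => rowStat i (cmkΞ i T c g)) ⁻¹' A ∩ (fun g => rowBool i (cmkΞ i T c g)) ⁻¹' {y}) := by
    rw [hν, Measure.map_apply hΞ ((hRS.inter hEv).inter hRB)]
    congr 1; ext g; simp only [tcE, mem_preimage, mem_inter_iff, mem_setOf_eq, mem_singleton_iff, ← hcdef]; tauto
  have e2 : νmix T (tcAtom i p ∩ tcZev i c z) = SDE.PJ (tcE i T p z) := by
    rw [hν, Measure.map_apply hΞ hEv]; rfl
  have e3 : νmix T ((tcAtom i p ∩ tcZev i c z) ∩ {x | rowBool i x = y}) =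
      SDE.PJ (tcE i T p z ∩ (fun g => rowBool i (cmkΞ i T c g)) ⁻¹' {y}) := by
    rw [hν, Measure.map_apply hΞ (hEv.inter hRB)]; rfl
  have e4 : νmix T ({x | rowStat i x ∈ A} ∩ (tcAtom i p ∩ tcZev i c z)) =
      SDE.PJ (tcE i T p z ∩ (fun g => rowStat i (cmkΞ i T c g)) ⁻¹' A) := by
    rw [hν, Measure.map_apply hΞ (hRS.inter hEv)]
    congr 1; ext g; simp only [tcE, mem_preimage, mem_inter_iff, mem_setOf_eq, ← hcdef]; tauto
  rw [e1, e2, e3, e4]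
  exact key

/-! ## §2 The kernel -/

/-- Both cuts are present: a cut row below `0` and a cut row above `0`. [folklore] -/
def tcBoth (i : ℤ) (p : Obs × Set (Site 2 × Site 2)) : Prop := cmkCstar i p ≤ -1 ∧ 1 ≤ cmkCfirst i p

/-- The atom event of a statistic value `t = (p, z)`: window data of `p` and middle rows `(c, 0)` of `z`. [folklore] -/
def tcEv (i : ℤ) (t : (Obs × Set (Site 2 × Site 2)) × Obs) : Set Obs := tcAtom i t.1 ∩ tcZev i (cmkCstar i t.1) t.2

/-- THE TWO-SIDED CUT-MARKOV KERNEL `tcK i T` (canonical atom version between two cuts, `cmkK` otherwise). [folklore] -/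
def tcK (i : ℤ) (T : Set ℤ) (t : (Obs × Set (Site 2 × Site 2)) × Obs) (y : Bool × Bool × Bool) : ℝ :=
  if tcBoth i t.1 then
    (if νmix T (tcEv i t) = 0 then (if y = (false, false, false) then 1 else 0)
      else (νmix T (tcEv i t ∩ {x | rowBool i x = y})).toReal / (νmix T (tcEv i t)).toReal)
  else cmkK i T t y

/-! ## §3 Measurability -/

/-- The set of environments with both cuts is measurable. [folklore] -/
theorem measurableSet_tcBoth (i : ℤ) : MeasurableSet {p : Obs × Set (Site 2 × Site 2) | tcBoth i p} :=
  ((cmk_measurable_cstar i) (measurableSet_Iic : MeasurableSet (Iic (-1 : ℤ)))).inter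
    ((cmk_measurable_cfirst i) (measurableSet_Ici : MeasurableSet (Ici (1 : ℤ))))

/-- The atom event is jointly measurable in (statistic value, configuration). [folklore] -/
theorem measurableSet_tcEv_prod (i : ℤ) :
    MeasurableSet {q : ((Obs × Set (Site 2 × Site 2)) × Obs) × Obs | q.2 ∈ tcEv i q.1} := by
  have hps : Measurable fun q : ((Obs × Set (Site 2 × Site 2)) × Obs) × Obs => pinnedStat i q.2 :=
    (measurable_pinnedStat i).comp measurable_snd
  have hp : Measurable fun q : ((Obs × Set (Site 2 × Site 2)) × Obs) × Obs => q.1.1 := measurable_fst.comp measurable_fst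
  have hcs1 : Measurable fun q : ((Obs × Set (Site 2 × Site 2)) × Obs) × Obs => cmkCstar i q.1.1 := (cmk_measurable_cstar i).comp hp
  have hcf1 : Measurable fun q : ((Obs × Set (Site 2 × Site 2)) × Obs) × Obs => cmkCfirst i q.1.1 := (cmk_measurable_cfirst i).comp hp
  have hcs2 : Measurable fun q : ((Obs × Set (Site 2 × Site 2)) × Obs) × Obs => cmkCstar i (pinnedStat i q.2) :=
    (cmk_measurable_cstar i).comp hps
  have hcf2 : Measurable fun q : ((Obs × Set (Site 2 × Site 2)) × Obs) × Obs => cmkCfirst i (pinnedStat i q.2) :=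
    (cmk_measurable_cfirst i).comp hps
  -- membership bits
  have mcell : ∀ v : Site 2, Measurable fun q : ((Obs × Set (Site 2 × Site 2)) × Obs) × Obs => v ∈ (pinnedStat i q.2).1.1 :=
    fun v => (measurable_set_mem v).comp (measurable_fst.comp (measurable_fst.comp hps))
  have mface : ∀ v : Site 2, Measurable fun q : ((Obs × Set (Site 2 × Site 2)) × Obs) × Obs => v ∈ (pinnedStat i q.2).1.2 :=
    fun v => (measurable_set_mem v).comp (measurable_snd.comp (measurable_fst.comp hps))
  have mpair : ∀ w : Site 2 × Site 2, Measurable fun q : ((Obs × Set (Site 2 × Site 2)) × Obs) × Obs => w ∈ (pinnedStat i q.2).2 :=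
    fun w => (measurable_set_mem w).comp (measurable_snd.comp hps)
  have pcell : ∀ v : Site 2, Measurable fun q : ((Obs × Set (Site 2 × Site 2)) × Obs) × Obs => v ∈ q.1.1.1.1 :=
    fun v => (measurable_set_mem v).comp (measurable_fst.comp (measurable_fst.comp hp))
  have pface : ∀ v : Site 2, Measurable fun q : ((Obs × Set (Site 2 × Site 2)) × Obs) × Obs => v ∈ q.1.1.1.2 :=
    fun v => (measurable_set_mem v).comp (measurable_snd.comp (measurable_fst.comp hp))
  have ppair : ∀ w : Site 2 × Site 2, Measurable fun q : ((Obs × Set (Site 2 × Site 2)) × Obs) × Obs => w ∈ q.1.1.2 :=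
    fun w => (measurable_set_mem w).comp (measurable_snd.comp hp)
  have xcell : ∀ v : Site 2, Measurable fun q : ((Obs × Set (Site 2 × Site 2)) × Obs) × Obs => v ∈ q.2.1 :=
    fun v => (measurable_set_mem v).comp (measurable_fst.comp measurable_snd)
  have xface : ∀ v : Site 2, Measurable fun q : ((Obs × Set (Site 2 × Site 2)) × Obs) × Obs => v ∈ q.2.2 :=
    fun v => (measurable_set_mem v).comp (measurable_snd.comp measurable_snd)
  have zcell : ∀ v : Site 2, Measurable fun q : ((Obs × Set (Site 2 × Site 2)) × Obs) × Obs => v ∈ q.1.2.1 :=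
    fun v => (measurable_set_mem v).comp (measurable_fst.comp (measurable_snd.comp measurable_fst))
  have zface : ∀ v : Site 2, Measurable fun q : ((Obs × Set (Site 2 × Site 2)) × Obs) × Obs => v ∈ q.1.2.2 :=
    fun v => (measurable_set_mem v).comp (measurable_snd.comp (measurable_snd.comp measurable_fst))
  -- integer comparisons with measurable integer-valued maps
  have mle : ∀ {f g : (((Obs × Set (Site 2 × Site 2)) × Obs) × Obs) → ℤ}, Measurable f → Measurable g →
      Measurable fun q => f q ≤ g q := fun hf hg => measurableSet_setOf.1 (measurableSet_le hf hg)
  have meq : ∀ {f g : (((Obs × Set (Site 2 × Site 2)) × Obs) × Obs) → ℤ}, Measurable f → Measurable g →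
      Measurable fun q => f q = g q := fun hf hg => measurableSet_setOf.1 (measurableSet_eq_fun hf hg)
  refine measurableSet_setOf.2 ?_
  simp only [tcEv, tcAtom, tcZev, EnvAgree, mem_inter_iff, mem_setOf_eq]
  refine ((meq hcs2 hcs1).and ((meq hcf2 hcf1).and ((Measurable.forall fun w => Measurable.imp measurable_const
    (Measurable.imp measurable_const (Measurable.imp (mle (hcs1.sub measurable_const) measurable_const)
      (Measurable.imp (mle measurable_const (hcf1.add measurable_const))
        (((mcell w).iff (pcell w)).and ((mface w).iff (pface w))))))).and
    (Measurable.forall fun w => Measurable.imp (mle (hcs1.sub measurable_const) measurable_const)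
      (Measurable.imp (mle measurable_const (hcf1.add measurable_const))
        (Measurable.imp (mle (hcs1.sub measurable_const) measurable_const)
          (Measurable.imp (mle measurable_const (hcf1.add measurable_const)) ((mpair w).iff (ppair w))))))))).and ?_
  exact Measurable.forall fun w => Measurable.imp (mle (hcs1.add measurable_const) measurable_const)
    (Measurable.imp measurable_const ((Measurable.imp measurable_const ((xcell w).iff (zcell w))).and
      (Measurable.imp measurable_const ((xface w).iff (zface w)))))

/-- The mass of the atom (cut by a fixed measurable event) is measurable in the statistic value. [folklore] -/
theorem measurable_nuMix_tcEv (i : ℤ) (T : Set ℤ) {G : Set Obs} (hG : MeasurableSet G) :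
    Measurable fun t : (Obs × Set (Site 2 × Site 2)) × Obs => νmix T (tcEv i t ∩ G) := by
  haveI := isProbabilityMeasure_nuMix T
  have hS : MeasurableSet {q : ((Obs × Set (Site 2 × Site 2)) × Obs) × Obs | q.2 ∈ tcEv i q.1 ∧ q.2 ∈ G} :=
    (measurableSet_tcEv_prod i).inter (measurable_snd hG)
  exact measurable_measure_prodMk_left (ν := νmix T) hS

/-- THE KERNEL IS MEASURABLE in the statistic value. [folklore] -/
theorem tc_kernel_measurable (i : ℤ) (T : Set ℤ) (y : Bool × Bool × Bool) : Measurable fun t => tcK i T t y := by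
  have hD : Measurable fun t : (Obs × Set (Site 2 × Site 2)) × Obs => νmix T (tcEv i t) := by
    simpa only [inter_univ] using measurable_nuMix_tcEv i T MeasurableSet.univ
  have hN : Measurable fun t : (Obs × Set (Site 2 × Site 2)) × Obs => νmix T (tcEv i t ∩ {x | rowBool i x = y}) :=
    measurable_nuMix_tcEv i T ((measurable_rowBool i) (measurableSet_singleton y))
  unfold tcK
  refine Measurable.ite ?_ (Measurable.ite (hD (measurableSet_singleton 0)) measurable_const
    (hN.ennreal_toReal.div hD.ennreal_toReal)) (cmk_kernel_measurable i T y)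
  exact measurable_fst (measurableSet_tcBoth i)

/-! ## §4 Nonnegativity and normalisation -/

/-- The kernel is nonnegative. [folklore] -/
theorem tc_kernel_nonneg (i : ℤ) (T : Set ℤ) (t : (Obs × Set (Site 2 × Site 2)) × Obs) (y : Bool × Bool × Bool) : 0 ≤ tcK i T t y := by
  unfold tcK
  split_ifs
  · exact zero_le_one
  · exact le_rfl
  · exact div_nonneg ENNReal.toReal_nonneg ENNReal.toReal_nonneg
  · exact cmk_kernel_nonneg i T t y

/-- The kernel is a probability vector at every statistic value. [folklore] -/
theorem tc_kernel_sum_one (i : ℤ) (T : Set ℤ) (t : (Obs × Set (Site 2 × Site 2)) × Obs) : ∑ y, tcK i T t y = 1 := by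
  haveI := isProbabilityMeasure_nuMix T
  by_cases hb : tcBoth i t.1
  · by_cases h0 : νmix T (tcEv i t) = 0
    · simp only [tcK, hb, if_true, h0]
      rw [Finset.sum_ite_eq']; simp
    · simp only [tcK, hb, if_true, h0, if_false]
      rw [← Finset.sum_div, ← ENNReal.toReal_sum (fun y _ => measure_ne_top _ _), crk_measure_eq_sum_rowBool i (νmix T) (tcEv i t)]
      exact div_self (ENNReal.toReal_ne_zero.2 ⟨h0, measure_ne_top _ _⟩)
  · simp only [tcK, hb, if_false]
    exact cmk_kernel_sum_one i T t

/-! ## §5 The kernel reads the past only above the last cut -/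

/-- Two pasts agreeing on the rows `≥ c + 1` for a cut row `c ≤ -1` of `p` define the same atom. [folklore] -/
theorem tcEv_congr_past (i : ℤ) (p : Obs × Set (Site 2 × Site 2)) (z z' : Obs) (c : ℤ) (hc : c ≤ -1) (hcut : IsCut i c p)
    (hz : ∀ w : Site 2, c + 1 ≤ w 1 → ((w ∈ z.1 ↔ w ∈ z'.1) ∧ (w ∈ z.2 ↔ w ∈ z'.2))) : tcEv i (p, z) = tcEv i (p, z') := by
  obtain ⟨-, h2, -⟩ := cmk_cstar_of_isCut i hc hcut
  ext x
  simp only [tcEv, mem_inter_iff, tcZev, mem_setOf_eq]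
  refine and_congr_right fun _ => forall_congr' fun w => ?_
  refine forall_congr' fun hw1 => forall_congr' fun _ => ?_
  obtain ⟨e1, e2⟩ := hz w (by omega)
  rw [e1, e2]

/-- THE KERNEL READS THE PAST ONLY STRICTLY ABOVE ANY CUT ROW BELOW `0`. [folklore] -/
theorem tc_kernel_reads (i : ℤ) (T : Set ℤ) (p : Obs × Set (Site 2 × Site 2)) (z z' : Obs) (c : ℤ) (hc : c ≤ -1)
    (hcut : IsCut i c p) (hz : ∀ w : Site 2, c + 1 ≤ w 1 → ((w ∈ z.1 ↔ w ∈ z'.1) ∧ (w ∈ z.2 ↔ w ∈ z'.2))) :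
    tcK i T (p, z) = tcK i T (p, z') := by
  funext y
  by_cases hb : tcBoth i p
  · simp only [tcK, hb, if_true, tcEv_congr_past i p z z' c hc hcut hz]
  · simp only [tcK, hb, if_false]
    exact congrFun (cmk_kernel_reads i T p z z' c hc hcut hz) y

/-! ## §6 Two-sided environment-locality -/

/-- Between the same two cut rows and under `EnvAgree` on the rows between them, two environments define the same atom.
[folklore] -/
theorem tcEv_congr_env (i : ℤ) {p p' : Obs × Set (Site 2 × Site 2)} (z : Obs) {c c' : ℤ} (hc : c ≤ -1) (hc' : 1 ≤ c')
    (h1 : IsCut i c p) (h2 : IsCut i c' p) (hag : EnvAgree i (c - 2) (c' + 2) p p') : tcEv i (p, z) = tcEv i (p', z) := by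
  obtain ⟨ecs, ecf⟩ := cstar_cfirst_congr_envAgree hc hc' h1 h2 hag
  obtain ⟨-, hcs2, -⟩ := cmk_cstar_of_isCut i hc h1
  obtain ⟨-, hcf2, -⟩ := cmk_cfirst_of_isCut i hc' h2
  have hag' : EnvAgree i (cmkCstar i p - 2) (cmkCfirst i p + 2) p p' := envAgree_mono hag (by omega) (by omega)
  ext x
  simp only [tcEv, tcAtom, mem_inter_iff, mem_setOf_eq, ← ecs, ← ecf]
  constructor
  · rintro ⟨⟨a1, a2, a3⟩, b⟩
    exact ⟨⟨a1, a2, envAgree_trans a3 hag'⟩, b⟩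
  · rintro ⟨⟨a1, a2, a3⟩, b⟩
    exact ⟨⟨a1, a2, envAgree_trans a3 (envAgree_symm hag')⟩, b⟩

/-- TWO-SIDED ENVIRONMENT-LOCALITY OF THE KERNEL (registered sub-goal `tc_readsEnv`). [folklore] -/
theorem tc_readsEnv : ∀ (i : ℤ) (T : Set ℤ), ReadsEnv i (tcK i T) := by
  intro i T p p' z c c' hc hc' h1 h2 h3 h4 hag
  have hb : tcBoth i p := ⟨(cmk_cstar_of_isCut i hc h1).1, (cmk_cfirst_of_isCut i hc' h2).1⟩
  have hb' : tcBoth i p' := ⟨(cmk_cstar_of_isCut i hc h3).1, (cmk_cfirst_of_isCut i hc' h4).1⟩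
  funext y
  simp only [tcK, hb, hb', if_true, tcEv_congr_env i z hc hc' h1 h2 hag]

end Summit.CriticalPhenomena.CardyFormulaZ2.Theorems.IKLinearTransport.PinnedDiagramExchange
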